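import Mathlib
import Summits.Ventures.PercRepro2.FiveTypedBridge

/-!
# Five typed edges: the alone-end reduction, II (blind cell PercRepro2, night-3, 2026-08-24)
`nonneg_of_alone5b`: an end among the points `10` … `14` alone in its class of the closed
configuration makes its edge inert.
-/

namespace Summit.Ventures.PercRepro2

open UnionCluster

namespace CovForm

namespace TwoTyped

open OneTyped TypedRed

section Alone5

open Classical

variable {V : Type*} {E : Type*} [Fintype E] [DecidableEq E] {R : Type*} [Field R]
  [LinearOrder R] [IsStrictOrderedRing R]
variable (ends : E → Sym2 V) (o a₁ a₂ a₃ b : V)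

set_option maxHeartbeats 4000000 in
/-- Alone ends at the points `10` … `14`: the count is nonnegative. -/
lemma nonneg_of_alone5b (hall4 : allOk4 = true) (e₁ e₂ e₃ e₄ e₅ : E) (z : Config E) (τ : E → ℕ)
    (hτ : ∀ e ∈ ({e₁, e₂, e₃, e₄, e₅} : Finset E), τ e = 1 ∨ τ e = 2) (z0 : Config E)
    (hz0c : closedOn ({e₁, e₂, e₃, e₄, e₅} : Finset E) z = z0) (ps : Fin 5 → V × V)
    (hends₁ : ends e₁ = s((ps 0).1, (ps 0).2))
    (hends₂ : ends e₂ = s((ps 1).1, (ps 1).2))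
    (hends₃ : ends e₃ = s((ps 2).1, (ps 2).2))
    (hends₄ : ends e₄ = s((ps 3).1, (ps 3).2))
    (hends₅ : ends e₅ = s((ps 4).1, (ps 4).2))
    (hA : let f := lab ends o a₁ a₂ a₃ b (xsOf5 ps) z0
      (f 10 = 10 ∧ ¬f 11 = 10 ∧ ¬f 12 = 10 ∧ ¬f 13 = 10 ∧ ¬f 14 = 10) ∨
      (f 11 = 11 ∧ ¬f 12 = 11 ∧ ¬f 13 = 11 ∧ ¬f 14 = 11) ∨
      (f 12 = 12 ∧ ¬f 13 = 12 ∧ ¬f 14 = 12) ∨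
      (f 13 = 13 ∧ ¬f 14 = 13) ∨
      (f 14 = 14)) :
    0 ≤ typedCount {e₁, e₂, e₃, e₄, e₅} z τ (K3 ends o a₁ a₂ a₃ b : Config E → Config E → Config E → R) := by
  set f := lab ends o a₁ a₂ a₃ b (xsOf5 ps) z0 with hfdef
  have hf : ∀ p q, f p = f q ↔ Conn ends z0 (pt o a₁ a₂ a₃ b (xsOf5 ps) p) (pt o a₁ a₂ a₃ b (xsOf5 ps) q) :=
    fun p q => lab_eq_iff ends o a₁ a₂ a₃ b (xsOf5 ps) z0 p q
  have hle : ∀ i, f i ≤ i := lab_le ends o a₁ a₂ a₃ b (xsOf5 ps) z0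
  simp only [] at hA
  rcases hA with h | h | h | h | h
  · obtain ⟨ea10_10, ea10_11, ea10_12, ea10_13, ea10_14⟩ := h
    have hp : ∀ q, q ≤ 14 → q ≠ 10 → f q ≠ f 10 := by
      intro q hq hqp
      have hl0 := hle 0
      have hl1 := hle 1
      have hl2 := hle 2
      have hl3 := hle 3
      have hl4 := hle 4
      have hl5 := hle 5
      have hl6 := hle 6
      have hl7 := hle 7
      have hl8 := hle 8
      have hl9 := hle 9
      have hl10 := hle 10
      have hl11 := hle 11
      have hl12 := hle 12
      have hl13 := hle 13
      have hl14 := hle 14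
      interval_cases q <;> omega
    refine nonneg_of_inert5 ends o a₁ a₂ a₃ b hall4 {e₁, e₂, e₃, e₄, e₅} e₃ (by simp) (Finset.card_le_five) hτ ?_
    refine typedCount_inert_of_alone ends o a₁ a₂ a₃ b {e₁, e₂, e₃, e₄, e₅} e₃ (by simp) (show ends e₃ = s((ps 2).2, (ps 2).1) by rw [hends₃, Sym2.eq_swap]) z τ ?_ ?_
    · rw [hz0c]
      rintro m (rfl | rfl | rfl | rfl | rfl) hc
      · exact hp 2 (by norm_num) (by norm_num) ((hf 2 10).mpr (conn_symm hc))
      · exact hp 0 (by norm_num) (by norm_num) ((hf 0 10).mpr (conn_symm hc))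
      · exact hp 1 (by norm_num) (by norm_num) ((hf 1 10).mpr (conn_symm hc))
      · exact hp 4 (by norm_num) (by norm_num) ((hf 4 10).mpr (conn_symm hc))
      · exact hp 3 (by norm_num) (by norm_num) ((hf 3 10).mpr (conn_symm hc))
    · rw [hz0c]
      intro f' hf' hne y hy hc
      simp only [Finset.mem_insert, Finset.mem_singleton] at hf'
      rcases hf' with rfl | rfl | rfl | rfl | rfl
      · rw [hends₁] at hy
        rcases Sym2.mem_iff.mp hy with rfl | rfl
        · exact hp 5 (by norm_num) (by norm_num) ((hf 5 10).mpr (conn_symm hc))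
        · exact hp 6 (by norm_num) (by norm_num) ((hf 6 10).mpr (conn_symm hc))
      · rw [hends₂] at hy
        rcases Sym2.mem_iff.mp hy with rfl | rfl
        · exact hp 7 (by norm_num) (by norm_num) ((hf 7 10).mpr (conn_symm hc))
        · exact hp 8 (by norm_num) (by norm_num) ((hf 8 10).mpr (conn_symm hc))
      · exact absurd rfl hne
      · rw [hends₄] at hy
        rcases Sym2.mem_iff.mp hy with rfl | rfl
        · exact hp 11 (by norm_num) (by norm_num) ((hf 11 10).mpr (conn_symm hc))
        · exact hp 12 (by norm_num) (by norm_num) ((hf 12 10).mpr (conn_symm hc))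
      · rw [hends₅] at hy
        rcases Sym2.mem_iff.mp hy with rfl | rfl
        · exact hp 13 (by norm_num) (by norm_num) ((hf 13 10).mpr (conn_symm hc))
        · exact hp 14 (by norm_num) (by norm_num) ((hf 14 10).mpr (conn_symm hc))
  · obtain ⟨ea11_11, ea11_12, ea11_13, ea11_14⟩ := h
    have hp : ∀ q, q ≤ 14 → q ≠ 11 → f q ≠ f 11 := by
      intro q hq hqp
      have hl0 := hle 0
      have hl1 := hle 1
      have hl2 := hle 2
      have hl3 := hle 3
      have hl4 := hle 4
      have hl5 := hle 5
      have hl6 := hle 6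
      have hl7 := hle 7
      have hl8 := hle 8
      have hl9 := hle 9
      have hl10 := hle 10
      have hl11 := hle 11
      have hl12 := hle 12
      have hl13 := hle 13
      have hl14 := hle 14
      interval_cases q <;> omega
    refine nonneg_of_inert5 ends o a₁ a₂ a₃ b hall4 {e₁, e₂, e₃, e₄, e₅} e₄ (by simp) (Finset.card_le_five) hτ ?_
    refine typedCount_inert_of_alone ends o a₁ a₂ a₃ b {e₁, e₂, e₃, e₄, e₅} e₄ (by simp) hends₄ z τ ?_ ?_
    · rw [hz0c]
      rintro m (rfl | rfl | rfl | rfl | rfl) hc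
      · exact hp 2 (by norm_num) (by norm_num) ((hf 2 11).mpr (conn_symm hc))
      · exact hp 0 (by norm_num) (by norm_num) ((hf 0 11).mpr (conn_symm hc))
      · exact hp 1 (by norm_num) (by norm_num) ((hf 1 11).mpr (conn_symm hc))
      · exact hp 4 (by norm_num) (by norm_num) ((hf 4 11).mpr (conn_symm hc))
      · exact hp 3 (by norm_num) (by norm_num) ((hf 3 11).mpr (conn_symm hc))
    · rw [hz0c]
      intro f' hf' hne y hy hc
      simp only [Finset.mem_insert, Finset.mem_singleton] at hf'
      rcases hf' with rfl | rfl | rfl | rfl | rfl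
      · rw [hends₁] at hy
        rcases Sym2.mem_iff.mp hy with rfl | rfl
        · exact hp 5 (by norm_num) (by norm_num) ((hf 5 11).mpr (conn_symm hc))
        · exact hp 6 (by norm_num) (by norm_num) ((hf 6 11).mpr (conn_symm hc))
      · rw [hends₂] at hy
        rcases Sym2.mem_iff.mp hy with rfl | rfl
        · exact hp 7 (by norm_num) (by norm_num) ((hf 7 11).mpr (conn_symm hc))
        · exact hp 8 (by norm_num) (by norm_num) ((hf 8 11).mpr (conn_symm hc))
      · rw [hends₃] at hy
        rcases Sym2.mem_iff.mp hy with rfl | rfl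
        · exact hp 9 (by norm_num) (by norm_num) ((hf 9 11).mpr (conn_symm hc))
        · exact hp 10 (by norm_num) (by norm_num) ((hf 10 11).mpr (conn_symm hc))
      · exact absurd rfl hne
      · rw [hends₅] at hy
        rcases Sym2.mem_iff.mp hy with rfl | rfl
        · exact hp 13 (by norm_num) (by norm_num) ((hf 13 11).mpr (conn_symm hc))
        · exact hp 14 (by norm_num) (by norm_num) ((hf 14 11).mpr (conn_symm hc))
  · obtain ⟨ea12_12, ea12_13, ea12_14⟩ := h
    have hp : ∀ q, q ≤ 14 → q ≠ 12 → f q ≠ f 12 := by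
      intro q hq hqp
      have hl0 := hle 0
      have hl1 := hle 1
      have hl2 := hle 2
      have hl3 := hle 3
      have hl4 := hle 4
      have hl5 := hle 5
      have hl6 := hle 6
      have hl7 := hle 7
      have hl8 := hle 8
      have hl9 := hle 9
      have hl10 := hle 10
      have hl11 := hle 11
      have hl12 := hle 12
      have hl13 := hle 13
      have hl14 := hle 14
      interval_cases q <;> omega
    refine nonneg_of_inert5 ends o a₁ a₂ a₃ b hall4 {e₁, e₂, e₃, e₄, e₅} e₄ (by simp) (Finset.card_le_five) hτ ?_
    refine typedCount_inert_of_alone ends o a₁ a₂ a₃ b {e₁, e₂, e₃, e₄, e₅} e₄ (by simp) (show ends e₄ = s((ps 3).2, (ps 3).1) by rw [hends₄, Sym2.eq_swap]) z τ ?_ ?_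
    · rw [hz0c]
      rintro m (rfl | rfl | rfl | rfl | rfl) hc
      · exact hp 2 (by norm_num) (by norm_num) ((hf 2 12).mpr (conn_symm hc))
      · exact hp 0 (by norm_num) (by norm_num) ((hf 0 12).mpr (conn_symm hc))
      · exact hp 1 (by norm_num) (by norm_num) ((hf 1 12).mpr (conn_symm hc))
      · exact hp 4 (by norm_num) (by norm_num) ((hf 4 12).mpr (conn_symm hc))
      · exact hp 3 (by norm_num) (by norm_num) ((hf 3 12).mpr (conn_symm hc))
    · rw [hz0c]
      intro f' hf' hne y hy hc
      simp only [Finset.mem_insert, Finset.mem_singleton] at hf'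
      rcases hf' with rfl | rfl | rfl | rfl | rfl
      · rw [hends₁] at hy
        rcases Sym2.mem_iff.mp hy with rfl | rfl
        · exact hp 5 (by norm_num) (by norm_num) ((hf 5 12).mpr (conn_symm hc))
        · exact hp 6 (by norm_num) (by norm_num) ((hf 6 12).mpr (conn_symm hc))
      · rw [hends₂] at hy
        rcases Sym2.mem_iff.mp hy with rfl | rfl
        · exact hp 7 (by norm_num) (by norm_num) ((hf 7 12).mpr (conn_symm hc))
        · exact hp 8 (by norm_num) (by norm_num) ((hf 8 12).mpr (conn_symm hc))
      · rw [hends₃] at hy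
        rcases Sym2.mem_iff.mp hy with rfl | rfl
        · exact hp 9 (by norm_num) (by norm_num) ((hf 9 12).mpr (conn_symm hc))
        · exact hp 10 (by norm_num) (by norm_num) ((hf 10 12).mpr (conn_symm hc))
      · exact absurd rfl hne
      · rw [hends₅] at hy
        rcases Sym2.mem_iff.mp hy with rfl | rfl
        · exact hp 13 (by norm_num) (by norm_num) ((hf 13 12).mpr (conn_symm hc))
        · exact hp 14 (by norm_num) (by norm_num) ((hf 14 12).mpr (conn_symm hc))
  · obtain ⟨ea13_13, ea13_14⟩ := h
    have hp : ∀ q, q ≤ 14 → q ≠ 13 → f q ≠ f 13 := by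
      intro q hq hqp
      have hl0 := hle 0
      have hl1 := hle 1
      have hl2 := hle 2
      have hl3 := hle 3
      have hl4 := hle 4
      have hl5 := hle 5
      have hl6 := hle 6
      have hl7 := hle 7
      have hl8 := hle 8
      have hl9 := hle 9
      have hl10 := hle 10
      have hl11 := hle 11
      have hl12 := hle 12
      have hl13 := hle 13
      have hl14 := hle 14
      interval_cases q <;> omega
    refine nonneg_of_inert5 ends o a₁ a₂ a₃ b hall4 {e₁, e₂, e₃, e₄, e₅} e₅ (by simp) (Finset.card_le_five) hτ ?_
    refine typedCount_inert_of_alone ends o a₁ a₂ a₃ b {e₁, e₂, e₃, e₄, e₅} e₅ (by simp) hends₅ z τ ?_ ?_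
    · rw [hz0c]
      rintro m (rfl | rfl | rfl | rfl | rfl) hc
      · exact hp 2 (by norm_num) (by norm_num) ((hf 2 13).mpr (conn_symm hc))
      · exact hp 0 (by norm_num) (by norm_num) ((hf 0 13).mpr (conn_symm hc))
      · exact hp 1 (by norm_num) (by norm_num) ((hf 1 13).mpr (conn_symm hc))
      · exact hp 4 (by norm_num) (by norm_num) ((hf 4 13).mpr (conn_symm hc))
      · exact hp 3 (by norm_num) (by norm_num) ((hf 3 13).mpr (conn_symm hc))
    · rw [hz0c]
      intro f' hf' hne y hy hc
      simp only [Finset.mem_insert, Finset.mem_singleton] at hf'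
      rcases hf' with rfl | rfl | rfl | rfl | rfl
      · rw [hends₁] at hy
        rcases Sym2.mem_iff.mp hy with rfl | rfl
        · exact hp 5 (by norm_num) (by norm_num) ((hf 5 13).mpr (conn_symm hc))
        · exact hp 6 (by norm_num) (by norm_num) ((hf 6 13).mpr (conn_symm hc))
      · rw [hends₂] at hy
        rcases Sym2.mem_iff.mp hy with rfl | rfl
        · exact hp 7 (by norm_num) (by norm_num) ((hf 7 13).mpr (conn_symm hc))
        · exact hp 8 (by norm_num) (by norm_num) ((hf 8 13).mpr (conn_symm hc))
      · rw [hends₃] at hy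
        rcases Sym2.mem_iff.mp hy with rfl | rfl
        · exact hp 9 (by norm_num) (by norm_num) ((hf 9 13).mpr (conn_symm hc))
        · exact hp 10 (by norm_num) (by norm_num) ((hf 10 13).mpr (conn_symm hc))
      · rw [hends₄] at hy
        rcases Sym2.mem_iff.mp hy with rfl | rfl
        · exact hp 11 (by norm_num) (by norm_num) ((hf 11 13).mpr (conn_symm hc))
        · exact hp 12 (by norm_num) (by norm_num) ((hf 12 13).mpr (conn_symm hc))
      · exact absurd rfl hne
  · have ea14_14 := h
    have hp : ∀ q, q ≤ 14 → q ≠ 14 → f q ≠ f 14 := by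
      intro q hq hqp
      have hl0 := hle 0
      have hl1 := hle 1
      have hl2 := hle 2
      have hl3 := hle 3
      have hl4 := hle 4
      have hl5 := hle 5
      have hl6 := hle 6
      have hl7 := hle 7
      have hl8 := hle 8
      have hl9 := hle 9
      have hl10 := hle 10
      have hl11 := hle 11
      have hl12 := hle 12
      have hl13 := hle 13
      have hl14 := hle 14
      interval_cases q <;> omega
    refine nonneg_of_inert5 ends o a₁ a₂ a₃ b hall4 {e₁, e₂, e₃, e₄, e₅} e₅ (by simp) (Finset.card_le_five) hτ ?_
    refine typedCount_inert_of_alone ends o a₁ a₂ a₃ b {e₁, e₂, e₃, e₄, e₅} e₅ (by simp) (show ends e₅ = s((ps 4).2, (ps 4).1) by rw [hends₅, Sym2.eq_swap]) z τ ?_ ?_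
    · rw [hz0c]
      rintro m (rfl | rfl | rfl | rfl | rfl) hc
      · exact hp 2 (by norm_num) (by norm_num) ((hf 2 14).mpr (conn_symm hc))
      · exact hp 0 (by norm_num) (by norm_num) ((hf 0 14).mpr (conn_symm hc))
      · exact hp 1 (by norm_num) (by norm_num) ((hf 1 14).mpr (conn_symm hc))
      · exact hp 4 (by norm_num) (by norm_num) ((hf 4 14).mpr (conn_symm hc))
      · exact hp 3 (by norm_num) (by norm_num) ((hf 3 14).mpr (conn_symm hc))
    · rw [hz0c]
      intro f' hf' hne y hy hc
      simp only [Finset.mem_insert, Finset.mem_singleton] at hf'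
      rcases hf' with rfl | rfl | rfl | rfl | rfl
      · rw [hends₁] at hy
        rcases Sym2.mem_iff.mp hy with rfl | rfl
        · exact hp 5 (by norm_num) (by norm_num) ((hf 5 14).mpr (conn_symm hc))
        · exact hp 6 (by norm_num) (by norm_num) ((hf 6 14).mpr (conn_symm hc))
      · rw [hends₂] at hy
        rcases Sym2.mem_iff.mp hy with rfl | rfl
        · exact hp 7 (by norm_num) (by norm_num) ((hf 7 14).mpr (conn_symm hc))
        · exact hp 8 (by norm_num) (by norm_num) ((hf 8 14).mpr (conn_symm hc))
      · rw [hends₃] at hy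
        rcases Sym2.mem_iff.mp hy with rfl | rfl
        · exact hp 9 (by norm_num) (by norm_num) ((hf 9 14).mpr (conn_symm hc))
        · exact hp 10 (by norm_num) (by norm_num) ((hf 10 14).mpr (conn_symm hc))
      · rw [hends₄] at hy
        rcases Sym2.mem_iff.mp hy with rfl | rfl
        · exact hp 11 (by norm_num) (by norm_num) ((hf 11 14).mpr (conn_symm hc))
        · exact hp 12 (by norm_num) (by norm_num) ((hf 12 14).mpr (conn_symm hc))
      · exact absurd rfl hne

end Alone5

end TwoTyped

end CovForm

end Summit.Ventures.PercRepro2
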